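import Summits.ResolutionOfSingularities.ResolutionOfSingularities.Theorems.UniversalCellsCampaignW82FamilyTransferGraded
import Mathlib.FieldTheory.IsAlgClosed.Basic
import HarnessLib

/-!
# [OURS · L1 W8.2] The climb kernel and the perfection step AT ALGEBRAICALLY CLOSED CONSTANT FIELDS — door 2
# (`UniformComplexity` / `PrimeModelTransfer`) of slot W8.2; campaign statements, Theses-free module

Cell `res-hironaka` (run/shared/lean/pub/res-hironaka/), LADDER-RESOLUTION rung L (RESCUE), slot W8.2 of
plan/RESCUE-SEED.md («PRIME-FIELD / UNIVERSALITY TRANSFER instead of descent»). SECOND DOOR: route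
`UniformComplexity`, item `PrimeModelTransfer` (stmt-ResolutionOfSingularities-8933: resolution over `𝔽̄_p` ⇒
resolution over every algebraically closed field of characteristic `p`), whose only open registered stub is the
shared climb kernel `stub_climbRatFuncPerf` = OURS `CampaignW82.ClimbRatFuncPerf p`
(Theorems/UniversalCellsCampaignW82PrimeFieldTransfer.lean, p460619; reduction
`Theorems.PrimeModelTransfer.primeModelTransfer_of_climbRatFuncPerf`, p461439). Statement-only file (typer
res-L1-type-o6, statement-only lane; two-lane rule: the slot's prover res-L1-s82-pv-2 proves AGAINST these names):
three OURS `Prop`s and five pure-logic anchors; NOTHING is proved about resolution of singularities here and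
nothing is asserted.

WHY THIS FILE. res-L1-s82-pv-2 (STATUS 2026-08-26T21:30:44Z, «TRDEG INDUCTION = split (a)») reduces door 2 to the
kernel AT ALGEBRAICALLY CLOSED `M` only: for `K` algebraically closed of characteristic `p` and `k₀ = 𝔽̄_p ⊆ K`,
climb along the tower of algebraically closed subfields `A(S)` = algebraic closure of `k₀(S)` in `K` (`S`
finite), each step being ONE kernel instance at the algebraically closed `M = A(S)` followed by the landed
algebraic climb `Theorems.PrimeFieldToPerfect.stub_climbAlgebraic`; the limit step uses that a resolution over
an algebraically closed (hence perfect) subfield stays a resolution after base field extension. «Door 2's honest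
residual is the kernel at algebraically closed M of finite trdeg over 𝔽_p, strictly inside the registered
kernel.» This file NAMES that residual, grades it by dimension like p466046, and factors it through the finite
level exactly as Theorems/UniversalCellsCampaignW82FamilyTransferGraded.lean (p469608) factors the full kernel:

  `ClimbRatFuncPerfAlgClosedDimLe p m n` ⇐ `SpreadOutRatFuncDimLe p m n` (finite-level family transfer,
  theorem-to-prove `FamilyTransferSucc`, ANY constant field) ∧ `PerfectionStepAlgClosedDimLe p n`
  (`climbRatFuncPerfAlgClosedDimLe_of_spreadOut_of_perfectionStepAlgClosed`, pure logic),

so that, once `FamilyTransferSucc p` lands, door 2 rests on the perfection step AT ALGEBRAICALLY CLOSED `M` in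
each dimension — for `n ≤ 3` a theorem (Cossart–Piltant, FACT-LIST F-02, hypothesis unused), for `n = 4` the
first open rung of door 2.

BUILD RULE (cell, director-resolution 2026-08-26T18:53:29Z (B)): OURS vocabulary file, THESES-FREE BY BIRTH —
imports only the Theses-free module p469608 (hence p466046), `Mathlib.FieldTheory.IsAlgClosed.Basic` and
`HarnessLib`. The identification of `ClimbRatFuncPerfAlgClosed p` with the body of the registered kernel
restricted to `[IsAlgClosed M]` is by inspection (binders copied from `CampaignW82.ClimbRatFuncPerf p`, with
`[PerfectField M]` replaced by `[IsAlgClosed M]`); the implication from the kernel is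
`climbRatFuncPerfAlgClosedDimLe_of_climbRatFuncPerfDimLe` (`IsAlgClosed.perfectField`).

HONEST FRAMING. The `def`s below are OURS — campaign statements that REPLACE THE ROLE of a printed item of
H. Hironaka's manuscript *Resolution of singularities in positive characteristics* (2017-03-23,
[Hironaka2017], lit key `paper:url-3343fd9e678b`) — namely §17 ¶2, p.89 l.59–62 («In this work the base field
K is always assumed to be a finite field or Z/pZ because our resolution is for all dimension. When the K has
transcendence degree d we can reformulate the resolution problem to the case of dimension d + dim Z»; typed AS
PRINTED as `Literature.AlgebraicGeometry.Hironaka2017.S17Methodology.U89_3` / `U89_3_ours`), here for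
ALGEBRAICALLY CLOSED target fields `K` (door 2's universe: `PrimeModelTransfer` climbs from `𝔽̄_p`, the
algebraic closure of «Z/pZ», to every algebraically closed `K`, i.e. to arbitrary transcendence degree over
`𝔽̄_p`, one transcendental and one algebraic closure at a time). NOT statements of the manuscript; nothing here
is attributed to its author; no typed candidate of the manuscript is used even as a hypothesis. AI
transcription, weaker than expert review.

CONTENT (non-embedded summit idiom as in p466046 / p469608):
* `ClimbRatFuncPerfAlgClosed p` — the registered kernel `CampaignW82.ClimbRatFuncPerf p` with the constant field
  `M` ALGEBRAICALLY CLOSED instead of perfect (binder for binder otherwise): the name for the hypothesis of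
  res-L1-s82-pv-2's closer `…PrimeModelTransferOfClimbAlgClosed.lean`.
* `ClimbRatFuncPerfAlgClosedDimLe p m n` — the same graded by dimension (`(⊤, ⊤)` = the above,
  `climbRatFuncPerfAlgClosed_iff_top`).
* `PerfectionStepAlgClosedDimLe p n` — the perfection step of p469608 with `M` algebraically closed: door 2's
  honest residual at grade `n`.
* anchors (pure logic; `IsAlgClosed.perfectField` in two of them): `climbRatFuncPerfAlgClosed_iff_top`,
  `climbRatFuncPerfAlgClosedDimLe_mono`, `climbRatFuncPerfAlgClosedDimLe_of_climbRatFuncPerfDimLe` (kernel grade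
  ⇒ algebraically closed kernel grade), `perfectionStepAlgClosedDimLe_of_perfectionStepDimLe`,
  `climbRatFuncPerfAlgClosedDimLe_of_spreadOut_of_perfectionStepAlgClosed` (THE FACTORISATION for door 2).

BARRIERS (catalogued under `Literature/Barriers/ResolutionOfSingularities/`, namespace
`Literature.Barriers.ResolutionOfSingularities`): restricting the constant field `M` to be algebraically closed
does NOT evade the transport barriers — they concern the purely inseparable extension
`RatFunc M ⊂ RatFunc M^{perf}` of the imperfect field `RatFunc M = M(t)`, which is imperfect for every `M`:
file `RegularNotGeometricallyRegular.lean` (Kollár 1.19), file `FrobeniusTwistResolution.lean` decl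
`not_hasResolution_Spec_frobTwist` (stated over `RatFunc (ZMod p)`; the same twist exists over `M(t)` for any
`M`), file `InseparableBaseChangeResolution.lean` decls `not_hasResolution_Spec_dualNumber` /
`not_hasResolution_pullback_extField` / `not_isRegular_stable_groundFieldExtension`. What the restriction buys
is recorded honestly: `M` algebraically closed makes every finite level `M(t^{1/p^e})` isomorphic to `RatFunc M`
(as for perfect `M`) AND makes `M(t)` a `C₁` field of a very special kind (Tsen) — no catalogued barrier and no
catalogued theorem distinguishes `PerfectionStepAlgClosedDimLe p 4` from `PerfectionStepDimLe p 4`; both are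
open-problem grade.

VACUITY SELF-CHECK (one line per decl in the docstrings): for prime `p` none of the three `Prop`s is trivially
false (each instance follows from the summit statement `ResolutionInChar p`); the graded ones are trivially true
exactly at `n = ⊥`; at `m = ⊥` the hypothesis of `ClimbRatFuncPerfAlgClosedDimLe` is idle (resolution over
`M(t)^{perf}` in dimension `≤ n` outright, open for `n ≥ 4`). Composite `p > 1`: vacuous; `p = 0`: not intended.

## References (vocabulary and locators only; nothing cited as a premise)
* H. Hironaka, ms. 2017-03-23, §17 ¶2 p.89 l.59–62 — under adjudication, quoted for the role replaced, not
  asserted. [Hironaka2017]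
* J. Kollár, *Lectures on Resolution of Singularities* (2007), 1.19 — the barrier example (catalogued, not used
  here). [Kollar2007]
* Cruxes/PrimeModelTransfer/STRATEGY-CENSUS.md («Transfer»); L/res-L1-k82/KILL-TEST-K8.2.md §4; L/SLOTS.md §2 W8.2;
  res-L1-s82-pv-2 STATUS 2026-08-26T21:30:44Z — cell files, OURS.
-/

noncomputable section

set_option linter.dupNamespace false -- mandated namespace of this single-conjunct summit

open _root_.CategoryTheory _root_.AlgebraicGeometry
open Literature.AlgebraicGeometry.Resolution

namespace Summit.ResolutionOfSingularities.ResolutionOfSingularities.Theorems.CampaignW82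

/-! ## The climb kernel at algebraically closed constant fields (door 2's hypothesis) -/

/-- [OURS · L1 W8.2] replaces the role of §17 ¶2, p.89 l.59–62 («a finite field or Z/pZ … When the K has
transcendence degree d we can reformulate the resolution problem to the case of dimension d + dim Z»; typed as
`S17Methodology.U89_3` / `U89_3_ours`) ONE TRANSCENDENTAL AT A TIME over an ALGEBRAICALLY CLOSED constant field,
for door 2 (`UniformComplexity.PrimeModelTransfer`, stmt-8933), in the non-embedded summit idiom; NOT a statement
of the manuscript.
THE CLIMB KERNEL AT ALGEBRAICALLY CLOSED `M`, at `p`: for every ALGEBRAICALLY CLOSED field `M` of characteristic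
`p` over which all integral separated schemes of finite type have resolutions, all integral separated schemes of
finite type over every PERFECT field `L` purely inseparable over `RatFunc M` (so `L ≅ M(t)^{perf}`) have
resolutions. Binder for binder the registered kernel `CampaignW82.ClimbRatFuncPerf p` (= stub
`stub_climbRatFuncPerf` of stmt-15233 and stmt-8933) with `[PerfectField M]` replaced by `[IsAlgClosed M]`;
implied by it (`climbRatFuncPerfAlgClosedDimLe_of_climbRatFuncPerfDimLe` with `climbRatFuncPerfAlgClosed_iff_top`,
via `IsAlgClosed.perfectField`), and — by res-L1-s82-pv-2's trdeg induction along algebraically closed subfields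
plus the landed `Theorems.PrimeFieldToPerfect.stub_climbAlgebraic` — expected to suffice for `PrimeModelTransfer` (a
closer of the shape `(∀ p, p.Prime → ClimbRatFuncPerfAlgClosed p) → Theses.UniformComplexity.PrimeModelTransfer`; not
proved here; the induction only ever meets `M` = the algebraic closure of a finitely generated field, i.e. of finite
transcendence degree over `𝔽_p` — a consumer wanting that sharper residual asks for the trdeg-graded sibling, to be
APPENDED here). Door 2's honest residual. Vacuity
(prime `p`): not trivially true (the conclusion contains resolution of integral schemes of dimension `≥ 4` over
`𝔽̄_p(t)^{perf}`, open) nor trivially false (implied by `ResolutionInChar p`); composite `p > 1` vacuous.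
[folklore] -/
def ClimbRatFuncPerfAlgClosed (p : ℕ) : Prop :=
  ∀ (M : Type) [Field M] [CharP M p] [IsAlgClosed M],
    (∀ (X : Scheme.{0}) (f : X ⟶ Spec (.of M)),
        IsSeparated f → LocallyOfFiniteType f → QuasiCompact f → IsIntegral X → Scheme.HasResolution X) →
      ∀ (L : Type) [Field L] [PerfectField L] [Algebra (RatFunc M) L] [IsPurelyInseparable (RatFunc M) L]
        (X : Scheme.{0}) (f : X ⟶ Spec (.of L)),
        IsSeparated f → LocallyOfFiniteType f → QuasiCompact f → IsIntegral X → Scheme.HasResolution X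

/-- [OURS · L1 W8.2] replaces the role of §17 ¶2, p.89 l.59–62 one transcendental at a time over an
ALGEBRAICALLY CLOSED constant field and GRADED BY DIMENSION on both sides (door 2); NOT a statement of the
manuscript. THE GRADED CLIMB KERNEL AT ALGEBRAICALLY CLOSED `M`, bounds `(m, n)`: for every algebraically closed
field `M` of characteristic `p` over which every integral separated `M`-scheme of finite type of dimension `≤ m`
has a resolution, every integral separated scheme of finite type of dimension `≤ n` over every perfect field `L`
purely inseparable over `RatFunc M` has a resolution. `CampaignW82.ClimbRatFuncPerfDimLe p m n` (p466046) with
`[PerfectField M]` replaced by `[IsAlgClosed M]`, and implied by it; `(⊤, ⊤)` is `ClimbRatFuncPerfAlgClosed p`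
(`climbRatFuncPerfAlgClosed_iff_top`); monotone in `m`, antitone in `n` (`climbRatFuncPerfAlgClosedDimLe_mono`);
FACTORS through the finite level: `SpreadOutRatFuncDimLe p m n → PerfectionStepAlgClosedDimLe p n →
ClimbRatFuncPerfAlgClosedDimLe p m n`. Rungs (not proved here): `n ≤ 3` from the named fact `CossartPiltant2019`
(F-02); `(n + 1, n)` ⇐ `FamilyTransferSucc p` + `PerfectionStepAlgClosedDimLe p n`; `(5, 4)` is the first open
rung of door 2. Vacuity (prime `p`): trivially true only at `n = ⊥`; at `m = ⊥` the hypothesis is idle; never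
trivially false; composite `p > 1` vacuous. [folklore] -/
def ClimbRatFuncPerfAlgClosedDimLe (p : ℕ) (m n : WithBot ℕ∞) : Prop :=
  ∀ (M : Type) [Field M] [CharP M p] [IsAlgClosed M],
    (∀ (X : Scheme.{0}) (f : X ⟶ Spec (.of M)),
        IsSeparated f → LocallyOfFiniteType f → QuasiCompact f → IsIntegral X →
          topologicalKrullDim X ≤ m → Scheme.HasResolution X) →
      ∀ (L : Type) [Field L] [PerfectField L] [Algebra (RatFunc M) L] [IsPurelyInseparable (RatFunc M) L]
        (X : Scheme.{0}) (f : X ⟶ Spec (.of L)),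
        IsSeparated f → LocallyOfFiniteType f → QuasiCompact f → IsIntegral X →
          topologicalKrullDim X ≤ n → Scheme.HasResolution X

/-! ## The perfection step at algebraically closed constant fields (door 2's honest residual, graded) -/

/-- [OURS · L1 W8.2] replaces the role of §17 ¶2, p.89 l.59–62 read with §2 p.4 l.22–24 («a perfect base field
K») for the target field `K = M(t)^{perf}` with `M` ALGEBRAICALLY CLOSED (door 2), ISOLATED from the finite-level
transfer and GRADED BY DIMENSION; NOT a statement of the manuscript. THE PERFECTION STEP AT ALGEBRAICALLY CLOSED
`M`, grade `n`: for every algebraically closed field `M` of characteristic `p` such that every integral separated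
scheme of finite type of dimension `≤ n` over `RatFunc M = M(t)` has a resolution, every integral separated
scheme of finite type of dimension `≤ n` over every perfect field `L` purely inseparable over `RatFunc M`
(`L ≅ M(t)^{perf}`) has a resolution. `CampaignW82.PerfectionStepDimLe p n` (p469608) with `[PerfectField M]`
replaced by `[IsAlgClosed M]`, and implied by it (`perfectionStepAlgClosedDimLe_of_perfectionStepDimLe`). With the
finite-level family transfer it gives the door-2 kernel grade
(`climbRatFuncPerfAlgClosedDimLe_of_spreadOut_of_perfectionStepAlgClosed`); once `FamilyTransferSucc p` is proved,
THIS is all that door 2 still asks, dimension by dimension. The hypothesis supplies REGULAR models over the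
imperfect field `M(t)`; the conclusion needs a model SMOOTH at some finite level `M(t^{1/p^e})`
(`Theorems.PrimeFieldToPerfect.stub_limitDescent`); «regular ⇒ geometrically regular» fails over `M(t)` for every
`M` (barrier files `RegularNotGeometricallyRegular.lean`, `InseparableBaseChangeResolution.lean`,
`FrobeniusTwistResolution.lean`) — algebraic closedness of `M` is not known to help. Rungs (not proved here):
`n ≤ 3` from `CossartPiltant2019` (F-02; hypothesis unused); `n = 4` is door 2's first open rung. Vacuity (prime
`p`): trivially true only at `n = ⊥`; never trivially false; NOT monotone in `n`; composite `p > 1` vacuous.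
[folklore] -/
def PerfectionStepAlgClosedDimLe (p : ℕ) (n : WithBot ℕ∞) : Prop :=
  ∀ (M : Type) [Field M] [CharP M p] [IsAlgClosed M],
    (∀ (X : Scheme.{0}) (f : X ⟶ Spec (.of (RatFunc M))),
        IsSeparated f → LocallyOfFiniteType f → QuasiCompact f → IsIntegral X →
          topologicalKrullDim X ≤ n → Scheme.HasResolution X) →
      ∀ (L : Type) [Field L] [PerfectField L] [Algebra (RatFunc M) L] [IsPurelyInseparable (RatFunc M) L]
        (X : Scheme.{0}) (f : X ⟶ Spec (.of L)),
        IsSeparated f → LocallyOfFiniteType f → QuasiCompact f → IsIntegral X →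
          topologicalKrullDim X ≤ n → Scheme.HasResolution X

/-! ## Pure-logic anchors -/

/-- **The ungraded door-2 kernel is the grade `(⊤, ⊤)`** (pure logic, `le_top`). [folklore] -/
theorem climbRatFuncPerfAlgClosed_iff_top (p : ℕ) :
    ClimbRatFuncPerfAlgClosed p ↔ ClimbRatFuncPerfAlgClosedDimLe p ⊤ ⊤ := by
  constructor
  · intro h M _ _ _ hM L _ _ _ _ X f hs hl hq hX _
    exact h M (fun Y g hs' hl' hq' hY => hM Y g hs' hl' hq' hY le_top) L X f hs hl hq hX
  · intro h M _ _ _ hM L _ _ _ _ X f hs hl hq hX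
    exact h M (fun Y g hs' hl' hq' hY _ => hM Y g hs' hl' hq' hY) L X f hs hl hq hX le_top

/-- **Monotonicity** (pure logic): `ClimbRatFuncPerfAlgClosedDimLe p m n → ClimbRatFuncPerfAlgClosedDimLe p m' n'`
whenever `m ≤ m'` and `n' ≤ n`. [folklore] -/
theorem climbRatFuncPerfAlgClosedDimLe_mono {p : ℕ} {m m' n n' : WithBot ℕ∞} (hm : m ≤ m') (hn : n' ≤ n)
    (h : ClimbRatFuncPerfAlgClosedDimLe p m n) : ClimbRatFuncPerfAlgClosedDimLe p m' n' :=
  fun M _ _ _ hM L _ _ _ _ X f hs hl hq hX hd =>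
    h M (fun Y g hs' hl' hq' hY hdY => hM Y g hs' hl' hq' hY (hdY.trans hm)) L X f hs hl hq hX
      (hd.trans hn)

/-- **The kernel grade implies the door-2 kernel grade** (an algebraically closed field is perfect,
`IsAlgClosed.perfectField`; otherwise pure logic). [folklore] -/
theorem climbRatFuncPerfAlgClosedDimLe_of_climbRatFuncPerfDimLe {p : ℕ} {m n : WithBot ℕ∞}
    (h : ClimbRatFuncPerfDimLe p m n) : ClimbRatFuncPerfAlgClosedDimLe p m n :=
  fun M _ _ _ hM L _ _ _ _ X f hs hl hq hX hd => by
    haveI : PerfectField M := IsAlgClosed.perfectField M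
    exact h M hM L X f hs hl hq hX hd

/-- **The perfection step implies its algebraically closed case** (`IsAlgClosed.perfectField`; otherwise pure
logic). [folklore] -/
theorem perfectionStepAlgClosedDimLe_of_perfectionStepDimLe {p : ℕ} {n : WithBot ℕ∞}
    (h : PerfectionStepDimLe p n) : PerfectionStepAlgClosedDimLe p n :=
  fun M _ _ _ hM L _ _ _ _ X f hs hl hq hX hd => by
    haveI : PerfectField M := IsAlgClosed.perfectField M
    exact h M hM L X f hs hl hq hX hd

/-- **THE FACTORISATION FOR DOOR 2** (pure logic): the finite-level family transfer at `(m, n)` (p469608, any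
constant field) and the perfection step at algebraically closed `M`, grade `n`, give the door-2 kernel grade
`(m, n)`. With `FamilyTransferSucc p`: `PerfectionStepAlgClosedDimLe p n → ClimbRatFuncPerfAlgClosedDimLe p
(n + 1) n`. [folklore] -/
theorem climbRatFuncPerfAlgClosedDimLe_of_spreadOut_of_perfectionStepAlgClosed {p : ℕ} {m n : WithBot ℕ∞}
    (h₁ : SpreadOutRatFuncDimLe p m n) (h₂ : PerfectionStepAlgClosedDimLe p n) :
    ClimbRatFuncPerfAlgClosedDimLe p m n :=
  fun M _ _ _ hM L _ _ _ _ X f hs hl hq hX hd =>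
    h₂ M (fun Y g hs' hl' hq' hY hdY => h₁ M hM Y g hs' hl' hq' hY hdY) L X f hs hl hq hX hd

end Summit.ResolutionOfSingularities.ResolutionOfSingularities.Theorems.CampaignW82

end
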